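import Summits.KontsevichZagierPeriods.KontsevichZagierPeriods.Theses.TwoRouteTransport

/-!
# `TransportGlue` (stmt-KontsevichZagierPeriods-12074, route TwoRouteTransport) — proof

`TransportGlue` is the implication `CubicTransportStable → BetaCancellation → CubicEndpoint`.

* `CubicTransportStable` says: for every real algebraic `x ∈ [0,1]`, any two representations on
  `(0,1)²` pinned to the two Euler kernels of Goursat's cubic at `a = 1/6` are *stably* equivalent:
  there is a list `l` of Beta-shaped one-dimensional representations with
  `l.foldr (fun β c => [β] * c) ([r] − [r']) ∈ relations`.
* `BetaCancellation` says every Beta-shaped representation is a non-zero-divisor modulo the moves: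
  `[β] * c ∈ relations → c ∈ relations`.
* `CubicEndpoint` is the `x = 1` fibre as a clean KZ-equivalence.

Proof: specialise the family at `x = 1` (algebraic, in `[0,1]`). Pointwise on `(0,1)²` the
`x = 1` kernels ARE the endpoint kernels: `(1 − t)^{-13/18} (1 − 1·t)^{-1/6} = (1 − t)^{-8/9}`,
`φ(1) = 1·(9−1)²/(3+1)³ = 1`, `(1 + 1/3)^{-1/6} = (3/4)^{1/6}` and
`(1 − t)^{-8/9} (1 − t)^{-1/18} = (1 − t)^{-17/18}` (`Real.rpow_add` on `0 < 1 − t`), so the two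
`Set.EqOn` hypotheses of `CubicEndpoint` transfer to those of the family statement. The resulting
spectator list is then peeled off the `List.foldr` product from the outside in, by induction on the
list, each step being one application of `BetaCancellation`; the empty fold is `[r] − [r']` itself,
which is `KZ.Equivalent r r'` by definition. (lead c10 of crux 9129, banking)
-/

namespace Summit.KontsevichZagierPeriods.TwoRouteTransport

open Literature.NumberTheory.Transcendental

/-- The algebraic prefactor at `x = 1`: `(1 + 1/3)^{-1/6} = (3/4)^{1/6}`. [folklore] -/
theorem transportGlue_const :
    (1 + 1 / 3 : ℝ) ^ (-(1:ℝ) / 6) = ((3:ℝ) / 4) ^ ((1:ℝ) / 6) := by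
  rw [show (1 + 1 / 3 : ℝ) = ((3:ℝ) / 4)⁻¹ by norm_num,
    Real.inv_rpow (by norm_num : (0:ℝ) ≤ 3 / 4), neg_div,
    Real.rpow_neg (by norm_num : (0:ℝ) ≤ 3 / 4), inv_inv]

/-- The first kernel at `x = 1`: `P · (1 − t)^{-13/18} · (1 − 1·t)^{-1/6} = P · (1 − t)^{-8/9}` for
`t < 1`. [folklore] -/
theorem transportGlue_left {t : ℝ} (ht : t < 1) (P : ℝ) :
    P * (1 - t) ^ (-(13:ℝ) / 18) * (1 - 1 * t) ^ (-(1:ℝ) / 6) = P * (1 - t) ^ (-(8:ℝ) / 9) := by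
  have h : (-(13:ℝ) / 18) + (-(1:ℝ) / 6) = -(8:ℝ) / 9 := by norm_num
  rw [one_mul, mul_assoc, ← Real.rpow_add (sub_pos.mpr ht), h]

/-- The second kernel at `x = 1`: with `φ(1) = 1·(9−1)²/(3+1)³ = 1`,
`(1 + 1/3)^{-1/6} · A · B · C · (1 − t)^{-8/9} · (1 − φ(1)·t)^{-1/18}
  = (3/4)^{1/6} · A · B · C · (1 − t)^{-17/18}` for `t < 1`
(the spectator factors `A`, `B`, `C` are kept separate so that the statement has the
left-associated shape of the route's integrands). [folklore] -/
theorem transportGlue_right {t : ℝ} (ht : t < 1) (A B C : ℝ) :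
    (1 + 1 / 3 : ℝ) ^ (-(1:ℝ) / 6) * A * B * C * (1 - t) ^ (-(8:ℝ) / 9) *
        (1 - (1 * (9 - 1) ^ 2 / (3 + 1) ^ 3) * t) ^ (-(1:ℝ) / 18) =
      ((3:ℝ) / 4) ^ ((1:ℝ) / 6) * A * B * C * (1 - t) ^ (-(17:ℝ) / 18) := by
  have h : (-(8:ℝ) / 9) + (-(1:ℝ) / 18) = -(17:ℝ) / 18 := by norm_num
  have hφ : (1 * (9 - 1) ^ 2 / (3 + 1) ^ 3 : ℝ) = 1 := by norm_num
  rw [hφ, one_mul, transportGlue_const, mul_assoc, ← Real.rpow_add (sub_pos.mpr ht), h]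

/-- **`TransportGlue`** (route TwoRouteTransport, stmt-KontsevichZagierPeriods-12074):
`CubicTransportStable → BetaCancellation → CubicEndpoint` — stable transport of Goursat's cubic
along `[0,1]` plus cancellation of Beta spectators gives the clean `x = 1` endpoint identity
`Γ(1/9)²Γ(4/9) = (3/4)^{1/6}Γ(1/3)Γ(5/18)Γ(1/18)` in Euler-period form. Proof: specialise the family
statement at `x = 1`, transfer the pinned integrands by the pointwise `rpow` identities
`transportGlue_left` / `transportGlue_right` on `(0,1)²`, then peel the spectators off the `foldr`
by induction on the list with `BetaCancellation`. [Kontsevich–Zagier 2001, §1.2] [folklore] -/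
theorem transportGlue_proof :
    Summit.KontsevichZagierPeriods.KontsevichZagierPeriods.Theses.TwoRouteTransport.TransportGlue :=
  by
  intro h₁ h₂ r r' hd hi hd' hi'
  have key := h₁ 1 isAlgebraic_one ⟨zero_le_one, le_rfl⟩ r r' hd ?_ hd' ?_
  · obtain ⟨l, hl, hmem⟩ := key
    induction l with
    | nil => rw [List.foldr_nil] at hmem; exact hmem
    | cons β l ih =>
      refine ih (fun b hb => hl b (List.mem_cons_of_mem _ hb)) ?_
      rw [List.foldr_cons] at hmem
      exact h₂ β (hl β List.mem_cons_self) _ hmem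
  · intro y hy
    have hy1 : y 1 ∈ Set.Ioo (0:ℝ) 1 := by rw [hd] at hy; exact hy 1
    rw [hi hy]
    exact (transportGlue_left hy1.2 _).symm
  · intro y hy
    have hy1 : y 1 ∈ Set.Ioo (0:ℝ) 1 := by rw [hd'] at hy; exact hy 1
    rw [hi' hy]
    exact (transportGlue_right hy1.2 _ _ _).symm

end Summit.KontsevichZagierPeriods.TwoRouteTransport
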